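import Summits.ResolutionOfSingularities.ResolutionOfSingularities.Theorems.HironakaBridgeLinks
import Literature.AlgebraicGeometry.Resolution.StrictTransformDistinct
import Literature.AlgebraicGeometry.Resolution.KollarStrictTransformPieces
import Literature.AlgebraicGeometry.Resolution.StrictTransformBaseChange
import Literature.AlgebraicGeometry.Resolution.BlowupSNC
import Literature.AlgebraicGeometry.Resolution.BlowupsFlatBaseChange
import Literature.AlgebraicGeometry.Resolution.BlowupsProperProofs
import Literature.AlgebraicGeometry.Resolution.PointBlowupHsFunMono
import Literature.AlgebraicGeometry.Resolution.EmbeddedResolution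
import Literature.AlgebraicGeometry.Resolution.MarkedIdealsLemmas
import Literature.AlgebraicGeometry.Resolution.StalkIdealLemmas

/-!
# RUNG B, GAP row G8-a discharged: a typed ERS (finitely many permissible blow-ups whose final
# scheme-theoretic strict transform is regular) yields a resolution of singularities

Cell `res-hironaka`, LADDER-RESOLUTION rung B (OURS; nothing here is a statement of any manuscript and
no candidate statement is asserted — the typed candidate `HironakaERSPerfect p` enters only as the
hypothesis of the `Prop` `ERSToEmbeddedSmoothRes p` of `Theorems/HironakaBridge.lean`, which this file
PROVES).

**The geometric content** (characteristic-free, no perfectness, no smoothness of the ambient used).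
Let `Z` be a locally Noetherian scheme over a field `K`, `I` a quasi-coherent ideal sheaf on `Z` whose
closed subscheme `Y = V(I)` is integral, and let `(σ : Z' → Z, X')` be an ERS-type sequence in the sense
of the typed §1 definition `Literature.AlgebraicGeometry.Hironaka2017.S01Introduction.IsERSSequence`:
`σ` is a composite of finitely many blow-ups `τ_j : Z_{j+1} → Z_j` (tree `IsBlowup`) whose centres
`V(C_j)` lie inside the singular (= non-regular) locus of the current scheme-theoretic strict
transform `V(X_j)`, and `X'` is the final scheme-theoretic strict transform
(`Resolution.strictTransformIdeal`, Görtz–Wedhorn I (13.19)). If `V(X')` is a regular scheme, then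
`V(X') → Y` is a resolution of singularities of `Y` (`hasResolution_of_isERS`): proper (blow-ups of
locally Noetherian schemes are proper, `IsBlowup.isProper`), birational (an isomorphism over the
dense open of `Y` above which no centre lies) and with regular source.

The induction (`isERSSequence_invariant`) carries along: `σ` proper; `I·𝒪_{Z'} ⊆ X'` (so that
`V(X') → Z` factors through `Y`); an open `V ∋ ξ` (the generic point of `Y`) over which `σ` is an
isomorphism; the unique point `ξ'` over `ξ`, which lies on `V(X')` with `𝒪_{Z',ξ'}/X'_{ξ'} ≅ 𝒪_{Y,ξ}`
a regular local ring (so the next centre, inside the singular locus, misses it); and irreducibility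
`V(X') ⊆ closure {ξ'}`. The last point is where the SCHEME-THEORETIC strict transform matters: it is
saturated with respect to the exceptional ideal (`stalkIdeal_strictTransformIdeal_eq_top_of_le_radical`),
hence has no component inside the exceptional divisor (`support_strictTransformIdeal_subset_closure`).

**Consequences for rung B.** `ersToEmbeddedSmoothRes_holds : ∀ p, ERSToEmbeddedSmoothRes p` (GAP row
G8-a); with `b0_holds`, `b1_holds`, `rungB_iff_descentAt` (`HironakaBridgeLinks.lean`) the whole ladder
from the TYPED §1 candidate over perfect fields to the summit now has EXACTLY ONE open hypothesis besides
the candidate itself: the crux `DescentPerfectToAll` (stmt-ResolutionOfSingularities-0549) —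
`resolutionOfSingularities_of_mainClaimPerfect_of_descentPerfectToAll`.

References: Görtz–Wedhorn I (2020), Def. 13.90, Prop. 13.91 (3), 13.96, (13.19) [GortzWedhorn2020];
BGMW 2011, arXiv:1206.3090, §3.3 (3)⇒(4), Thm. 2.0.3 [BierstoneGrigorievMilmanWlodarczyk2011].
-/

noncomputable section

set_option linter.dupNamespace false -- mandated namespace of this single-conjunct summit

universe u

namespace Summit.ResolutionOfSingularities.ResolutionOfSingularities.Theorems

open CategoryTheory CategoryTheory.Limits AlgebraicGeometry TopologicalSpace IsLocalRing
open Literature.AlgebraicGeometry.Resolution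
open Literature.AlgebraicGeometry.Hironaka2017.S01Introduction
open Scheme.IdealSheafData

/-! ## The scheme-theoretic strict transform has no component inside the exceptional divisor -/

/-- **No component of a strict transform lies in the exceptional divisor.** For a morphism
`π : X' → X` with `X'` locally Noetherian and ideal sheaves `C, K` on `X`, the support of the strict
transform `S = ⋃ₙ (π^* K : (π^* C)ⁿ)` of `K` is the closure of its part off `V(π^* C)`: at a point of
`V(S)` having a neighbourhood in which `V(S) ⊆ V(π^* C)`, the exceptional ideal would lie in the radical
of `S`, forcing `S = 𝒪` there by saturation (`stalkIdeal_strictTransformIdeal_eq_top_of_le_radical`).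
[cite: GortzWedhorn2020, (13.19) p. 414] -/
theorem support_strictTransformIdeal_subset_closure {X X' : Scheme.{u}} [IsLocallyNoetherian X']
    (π : X' ⟶ X) (C K : X.IdealSheafData) :
    ((strictTransformIdeal π C K).support : Set X') ⊆
      closure (((strictTransformIdeal π C K).support : Set X') \ (C.comap π).support) := by
  classical
  set S := strictTransformIdeal π C K with hS
  set F := C.comap π with hF
  intro s hs
  by_contra hsD
  -- the closed set `D = closure (V(S) ∖ V(F))` and its vanishing ideal `J`, a unit at `s`
  set D : Closeds X' := ⟨closure ((S.support : Set X') \ F.support), isClosed_closure⟩ with hD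
  have hsJ : s ∉ ((vanishingIdeal D).support : Set X') := by
    rw [Scheme.IdealSheafData.coe_support_vanishingIdeal]; exact hsD
  have hJtop : stalkIdeal (vanishingIdeal D) s = ⊤ := stalkIdeal_eq_top_of_not_mem_support hsJ
  -- `V(S) ⊆ V(F) ∪ D = V(F * J)`, hence `F * J ≤ √S`
  have hsupp : S.support ≤ (F * vanishingIdeal D).support := by
    intro x hx
    rw [support_mul]
    by_cases hxF : x ∈ F.support
    · exact Or.inl hxF
    · refine Or.inr ?_
      show x ∈ ((vanishingIdeal D).support : Set X')
      rw [Scheme.IdealSheafData.coe_support_vanishingIdeal]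
      exact subset_closure ⟨hx, hxF⟩
  have hle : F * vanishingIdeal D ≤ S.radical := by
    rw [← vanishingIdeal_support]
    exact (le_support_iff_le_vanishingIdeal.mp le_rfl).trans (vanishingIdeal_antimono hsupp)
  -- at the stalk at `s`: `F_s ≤ √(S_s)`, so `S_s = ⊤`, contradicting `s ∈ V(S)`
  have hrad : stalkIdeal F s ≤ (stalkIdeal S s).radical := by
    have h1 := stalkIdeal_mono hle s
    rw [stalkIdeal_mul, hJtop, Ideal.mul_top, stalkIdeal_radical] at h1
    exact h1
  have htop : stalkIdeal S s = ⊤ := stalkIdeal_strictTransformIdeal_eq_top_of_le_radical π C K hrad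
  have := (mem_support_iff_stalkIdeal_le S s).mp hs
  rw [htop, top_le_iff] at this
  exact (maximalIdeal.isMaximal (X'.presheaf.stalk s)).ne_top this

/-! ## Points with exactly one preimage -/

/-- If `f` is an isomorphism over the open `W` and `f x ∈ W`, the fibre of `f` through `x` is `{x}`.
[folklore] -/
theorem preimage_singleton_eq_of_isIso_morphismRestrict {X Y : Scheme.{u}} (f : X ⟶ Y) {W : Y.Opens}
    (hW : IsIso (f ∣_ W)) {x : X} (hx : f x ∈ W) : f ⁻¹' {f x} = {x} := by
  obtain ⟨x₀, -, huniq⟩ := existsUnique_preimage_of_isIso_morphismRestrict f hW hx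
  ext z
  simp only [Set.mem_preimage, Set.mem_singleton_iff]
  exact ⟨fun hz => (huniq z hz).trans (huniq x rfl).symm, fun hz => hz ▸ rfl⟩

/-! ## The invariant of an ERS-type sequence over an integral closed subscheme -/

section Invariant

variable {K : Type u} [Field K] {Z : Scheme.{u}} (g : Z ⟶ Spec (.of K)) [IsLocallyNoetherian Z]
  (I : Z.IdealSheafData) [IsIntegral I.subscheme]

/-- **The invariant.** Along an ERS-type sequence `(σ : Z' → Z, X')` starting from an integral closed
subscheme `Y = V(I)` with generic point `ξ` (as a point of `Z`): `σ` is proper; `I·𝒪_{Z'} ⊆ X'`; there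
is an open `V ∋ ξ` over which `σ` is an isomorphism; the point `ξ'` over `ξ` lies on `V(X')`, the
quotient `𝒪_{Z',ξ'}/X'_{ξ'}` is a regular local ring, and `V(X') ⊆ closure {ξ'}`. Induction on the
sequence: each blow-up is proper and an isomorphism off its centre; the centre lies in the singular
locus of `V(X_j)` and therefore misses `ξ'` (a regular point); off the exceptional divisor the new
strict transform is the total transform (`stalkIdeal_strictTransformIdeal_of_not_mem`), and it has no
component inside the exceptional divisor (`support_strictTransformIdeal_subset_closure`). [folklore] -/
theorem isERSSequence_invariant {Z' : Scheme.{u}} {σ : Z' ⟶ Z} {X' : Z'.IdealSheafData}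
    (h : IsERSSequence g I σ X') :
    IsProper σ ∧ I.comap σ ≤ X' ∧
    ∃ V : Z.Opens, I.subschemeι (genericPoint I.subscheme) ∈ V ∧ IsIso (σ ∣_ V) ∧
    ∃ ξ' : Z', σ ξ' = I.subschemeι (genericPoint I.subscheme) ∧ ξ' ∈ X'.support ∧
      IsRegularLocalRing (Z'.presheaf.stalk ξ' ⧸ stalkIdeal X' ξ') ∧
      (X'.support : Set Z') ⊆ closure {ξ'} := by
  classical
  set η := genericPoint I.subscheme with hη
  set ξ : Z := I.subschemeι η with hξdef
  induction h with
  | refl =>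
    refine ⟨inferInstance, by rw [comap_id], ⊤, trivial, ?_, ξ, rfl, ?_, ?_, ?_⟩
    · infer_instance
    · show ξ ∈ (I.support : Set Z)
      rw [← range_subschemeι]
      exact Set.mem_range_self η
    · -- `𝒪_{Z,ξ}/I_ξ ≅ 𝒪_{Y,η}`, the function field of the integral `Y`
      have hfield : IsRegularLocalRing (I.subscheme.presheaf.stalk η) := by
        change IsRegularLocalRing I.subscheme.functionField
        infer_instance
      exact (isRegularLocalRing_stalk_subscheme_iff I η).mp hfield
    · -- `V(I) = ι(Y) = closure {ξ}`
      have hgen := (genericPoint_spec I.subscheme).image I.subschemeι.continuous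
      rw [Set.image_univ, I.subschemeι.isClosedEmbedding.isClosed_range.closure_eq] at hgen
      rw [← range_subschemeι]
      exact hgen.symm.le
  | @blowup Z' Z'' σ X' h C τ hτ hirr hsm hsing ih =>
    obtain ⟨hσ, hcomap, V, hξV, hiso, ξ', hξ', hξ'X, hreg, hirrX⟩ := ih
    haveI := hσ
    haveI : IsLocallyNoetherian Z' := LocallyOfFiniteType.isLocallyNoetherian σ
    haveI : IsProper τ := hτ.isProper
    haveI : IsLocallyNoetherian Z'' := LocallyOfFiniteType.isLocallyNoetherian τ
    -- (1) the centre misses `ξ'`, a regular point of `V(X')`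
    have hξ'C : ξ' ∉ (C.support : Set Z') := by
      intro hmem
      obtain ⟨x, hx, hxξ⟩ := hsing hmem
      apply hx
      show IsRegularLocalRing (X'.subscheme.presheaf.stalk x)
      rw [isRegularLocalRing_stalk_subscheme_iff X' x]
      have hxξ' : X'.subschemeι.base x = ξ' := hxξ
      rw [hxξ']
      exact hreg
    -- (2) `τ` is an isomorphism off the centre; the point `ξ''` over `ξ'`
    let Wc : Z'.Opens := ⟨(C.support : Set Z')ᶜ, C.support.isClosed.isOpen_compl⟩
    have hWc : IsIso (τ ∣_ Wc) := hτ.isIso_morphismRestrict disjoint_compl_left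
    obtain ⟨ξ'', hξ'', huniq⟩ := existsUnique_preimage_of_isIso_morphismRestrict τ hWc (y := ξ') hξ'C
    have hfibξ' : τ ⁻¹' {ξ'} = {ξ''} := by
      have := preimage_singleton_eq_of_isIso_morphismRestrict τ hWc (x := ξ'') (hξ''.symm ▸ hξ'C)
      rwa [hξ''] at this
    have hξ''E : ξ'' ∉ ((C.comap τ).support : Set Z'') := by
      rw [support_comap]
      show τ ξ'' ∉ (C.support : Set Z')
      rw [hξ'']; exact hξ'C
    -- (3) the stalk of the new strict transform at `ξ''` is the image of `X'_{ξ'}` under the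
    --     isomorphism `𝒪_{Z',ξ'} ≅ 𝒪_{Z'',ξ''}`
    haveI hst : IsIso (τ.stalkMap ξ'') :=
      isIso_stalkMap_of_isIso_morphismRestrict τ Wc ξ'' (show τ ξ'' ∈ Wc from hξ''.symm ▸ hξ'C)
    let φ : Z'.presheaf.stalk (τ ξ'') ≃+* Z''.presheaf.stalk ξ'' :=
      (asIso (τ.stalkMap ξ'')).commRingCatIsoToRingEquiv
    have hSξ'' : stalkIdeal (strictTransformIdeal τ C X') ξ'' =
        (stalkIdeal X' (τ ξ'')).map (φ : Z'.presheaf.stalk (τ ξ'') →+* Z''.presheaf.stalk ξ'') :=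
      stalkIdeal_strictTransformIdeal_of_not_mem τ C X' hξ''E
    refine ⟨inferInstance, ?_, V ⊓ ⟨(σ '' (C.support : Set Z'))ᶜ,
      (σ.isClosedMap _ C.support.isClosed).isOpen_compl⟩, ⟨hξV, ?_⟩, ?_, ξ'', ?_, ?_, ?_, ?_⟩
    · -- `I·𝒪 ⊆` strict transform
      rw [comap_comp]
      exact (Scheme.IdealSheafData.comap_mono τ hcomap).trans (comap_le_strictTransformIdeal τ C X')
    · -- `ξ` is not under the centre
      rintro ⟨c, hc, hcξ⟩
      obtain ⟨c₀, -, huniq₀⟩ := existsUnique_preimage_of_isIso_morphismRestrict σ hiso hξV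
      have : c = ξ' := (huniq₀ c hcξ).trans (huniq₀ ξ' hξ').symm
      exact hξ'C (this ▸ hc)
    · -- `τ ≫ σ` is an isomorphism over the shrunken open
      set V' : Z.Opens := V ⊓ ⟨(σ '' (C.support : Set Z'))ᶜ,
        (σ.isClosedMap _ C.support.isClosed).isOpen_compl⟩ with hV'
      have hV'V : V' ≤ V := inf_le_left
      have hle : σ ⁻¹ᵁ V' ≤ Wc := fun x hx hxC => hx.2 ⟨x, hxC, rfl⟩
      rw [morphismRestrict_comp]
      have h1 := isIso_morphismRestrict_of_le σ hiso hV'V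
      have h2 := isIso_morphismRestrict_of_le τ hWc hle
      exact @IsIso.comp_isIso _ _ _ _ _ _ _ h2 h1
    · -- `ξ''` lies over `ξ`
      rw [Scheme.Hom.comp_apply, hξ'', hξ']
    · -- `ξ''` lies on the strict transform
      rw [mem_support_iff_stalkIdeal_le, hSξ'']
      have hX'le : stalkIdeal X' (τ ξ'') ≤ maximalIdeal _ := by
        rw [← mem_support_iff_stalkIdeal_le, hξ'']; exact hξ'X
      have hm := Ideal.map_mono (f := (φ : Z'.presheaf.stalk (τ ξ'') →+* Z''.presheaf.stalk ξ''))
        hX'le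
      rwa [show Ideal.map (φ : Z'.presheaf.stalk (τ ξ'') →+* Z''.presheaf.stalk ξ'')
          (maximalIdeal _) = maximalIdeal _ from IsLocalRing.map_ringEquiv_maximalIdeal φ] at hm
    · -- `𝒪_{Z'',ξ''}/S_{ξ''} ≅ 𝒪_{Z',ξ'}/X'_{ξ'}` is regular
      have hreg' : IsRegularLocalRing (Z'.presheaf.stalk (τ ξ'') ⧸ stalkIdeal X' (τ ξ'')) := by
        rw [hξ'']; exact hreg
      haveI := hreg'
      exact IsRegularLocalRing.of_ringEquiv
        (Ideal.quotientEquiv (stalkIdeal X' (τ ξ'')) (stalkIdeal (strictTransformIdeal τ C X') ξ'')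
          φ hSξ'')
    · -- irreducibility: the strict transform is the closure of its part off the exceptional
      --   divisor, which lies over `V(X') ∖ V(C) ⊆ closure {ξ'}` where `τ` is an isomorphism
      intro s hs
      have key : ((strictTransformIdeal τ C X').support : Set Z'') \ (C.comap τ).support ⊆
          closure {ξ''} := by
        rintro x ⟨hxS, hxE⟩
        have hτx : τ x ∈ (X'.support : Set Z') :=
          mem_support_of_mem_support_strictTransformIdeal (π := τ) (C := C) hxS
        have hτxC : τ x ∉ (C.support : Set Z') := by
          intro hmem
          apply hxE
          rw [support_comap]
          exact hmem
        have h2 := preimage_closure_inter_subset_of_isIso_morphismRestrict τ hWc {ξ'}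
          ⟨show x ∈ τ ⁻¹' closure {ξ'} from hirrX hτx, hτxC⟩
        rwa [hfibξ'] at h2
      exact closure_minimal key isClosed_closure
        (support_strictTransformIdeal_subset_closure τ C X' hs)

/-- **An ERS of an integral closed subscheme is a resolution of singularities.** Let `Z` be a locally
Noetherian scheme over a field `K`, `Y = V(I) ⊂ Z` an integral closed subscheme, and
`(σ : Z' → Z, X')` an ERS of `Y ⊂ Z` in the sense of the typed §1 definition
(`S01Introduction.IsERS`: finitely many blow-ups in centres inside the singular loci of the successive
scheme-theoretic strict transforms, final strict transform `V(X')` regular). Then `V(X') → Y` is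
proper and birational with regular source, so `Y` has a resolution of singularities
(`Scheme.HasResolution`). [folklore] -/
theorem hasResolution_of_isERS {Z' : Scheme.{u}} {σ : Z' ⟶ Z} {X' : Z'.IdealSheafData}
    (h : IsERS g I σ X') : Scheme.HasResolution I.subscheme := by
  classical
  obtain ⟨hseq, hreg⟩ := h
  obtain ⟨hσ, hcomap, V, hξV, hiso, ξ', hξ', hξ'X, -, hirrX⟩ := isERSSequence_invariant g I hseq
  haveI := hσ
  -- notation
  set η := genericPoint I.subscheme with hη
  set ι := I.subschemeι with hιdef
  set ξ : Z := ι η with hξdef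
  set j := X'.subschemeι with hjdef
  -- `ι(Y) = closure {ξ}`, `σ⁻¹ {ξ} = {ξ'}`, `V(X') = closure {ξ'}`
  have hYξ : Set.range ι = closure {ξ} := by
    have hgen := (genericPoint_spec I.subscheme).image ι.continuous
    rw [Set.image_univ, ι.isClosedEmbedding.isClosed_range.closure_eq] at hgen
    exact hgen.symm
  have hfibξ : σ ⁻¹' {ξ} = {ξ'} := by
    have := preimage_singleton_eq_of_isIso_morphismRestrict σ hiso (x := ξ') (hξ'.symm ▸ hξV)
    rwa [hξ'] at this
  have hrange : Set.range j = closure {ξ'} := by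
    rw [hjdef, range_subschemeι]
    exact le_antisymm hirrX
      (closure_minimal (Set.singleton_subset_iff.mpr hξ'X) X'.support.isClosed)
  -- the morphism `ρ : V(X') → Y` (through which `V(X') ↪ Z' → Z` factors since `I·𝒪_{Z'} ⊆ X'`)
  have H : I ≤ X'.map σ := le_map_iff_comap_le.mpr hcomap
  let ρ : X'.subscheme ⟶ I.subscheme := subschemeMap X' I σ H
  have hρ : ρ ≫ ι = j ≫ σ := subschemeMap_subschemeι X' I σ H
  have hρapp : ∀ y, ι (ρ y) = σ (j y) := fun y => by
    rw [← Scheme.Hom.comp_apply, hρ, Scheme.Hom.comp_apply]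
  -- properness
  haveI : IsProper ρ := by
    have : IsProper (ρ ≫ ι) := by rw [hρ]; infer_instance
    exact MorphismProperty.of_postcomp (W := @IsProper) (W' := @IsSeparated) ρ ι inferInstance this
  -- the dense open `U = ι⁻¹ V` of `Y` and the point `y₀` of `V(X')` over `ξ'`
  let U : I.subscheme.Opens := ι ⁻¹ᵁ V
  have hηU : η ∈ U := hξV
  obtain ⟨y₀, hy₀⟩ : ξ' ∈ Set.range j := by rw [hrange]; exact subset_closure rfl
  -- points of `Z'` over `ι(Y) ∩ V` lie on the strict transform
  have hover : ∀ x : Z', σ x ∈ Set.range ι → σ x ∈ V → x ∈ closure {ξ'} := by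
    intro x hx hxV
    rw [hYξ] at hx
    have := preimage_closure_inter_subset_of_isIso_morphismRestrict σ hiso {ξ} ⟨hx, hxV⟩
    rwa [hfibξ] at this
  have hbir : IsBirational ρ := by
    refine ⟨U, ?_, ?_, ?_⟩
    · -- `U` contains the generic point of `Y`
      have hd : Dense ({η} : Set I.subscheme) := by
        rw [dense_iff_closure_eq]; exact genericPoint_spec I.subscheme
      exact hd.mono (Set.singleton_subset_iff.mpr hηU)
    · -- `ρ⁻¹ U` contains the generic point `y₀` of `V(X')`
      have hgen' : closure ({y₀} : Set X'.subscheme) = Set.univ := by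
        rw [j.isClosedEmbedding.isInducing.closure_eq_preimage_closure_image, Set.image_singleton,
          hy₀, ← hrange, Set.preimage_range]
      have hd : Dense ({y₀} : Set X'.subscheme) := by
        rw [dense_iff_closure_eq]; exact hgen'
      refine hd.mono (Set.singleton_subset_iff.mpr ?_)
      change ι (ρ y₀) ∈ V
      rw [hρapp, hy₀, hξ']
      exact hξV
    · -- over `U`, `ρ` is a surjective closed immersion onto a reduced scheme
      haveI : IsClosedImmersion (ρ ∣_ U) := by
        have h1 : IsClosedImmersion ((j ≫ σ) ∣_ V) := by
          rw [morphismRestrict_comp]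
          haveI := hiso
          exact (MorphismProperty.cancel_right_of_respectsIso @IsClosedImmersion _ _).mpr
            (IsZariskiLocalAtTarget.restrict (inferInstanceAs (IsClosedImmersion j)) _)
        rw [← hρ, morphismRestrict_comp] at h1
        exact MorphismProperty.of_postcomp (W := @IsClosedImmersion) (W' := @IsSeparated)
          (ρ ∣_ U) (ι ∣_ V) inferInstance h1
      haveI : Surjective (ρ ∣_ U) := by
        refine ⟨fun u => ?_⟩
        have hu : ι u.1 ∈ V := u.2
        obtain ⟨x, hx, -⟩ := existsUnique_preimage_of_isIso_morphismRestrict σ hiso hu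
        have hxZ : x ∈ Set.range j := by
          rw [hrange]
          exact hover x (hx ▸ Set.mem_range_self _) (hx ▸ hu)
        obtain ⟨y₁, rfl⟩ := hxZ
        have hρy₁ : ρ y₁ = u.1 := ι.isClosedEmbedding.injective (by rw [hρapp, hx])
        refine ⟨⟨y₁, show ρ y₁ ∈ U by rw [hρy₁]; exact u.2⟩, Subtype.ext ?_⟩
        rw [morphismRestrict_base_coe]
        exact hρy₁
      exact isIso_of_isClosedImmersion_of_surjective _
  exact ⟨_, ρ, ⟨inferInstance, hbir, hreg⟩⟩

end Invariant

/-! ## Rung B: G8-a discharged, and the ladder with stmt-0549 as its only open hypothesis -/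

/-- **GAP row G8-a holds**: `ERSToEmbeddedSmoothRes p` — the typed §1 candidate at `p`
(`HironakaERSPerfect p`: an ERS for every closed subscheme of every smooth irreducible quasi-compact
scheme over every perfect field of characteristic `p`; a HYPOTHESIS here) implies its non-embedded
consequence-shape `EmbeddedSmoothResPerfect p`: an integral closed `i : X ↪ Z` is `X ≅ V(ker i)`, and an
ERS of `V(ker i) ⊂ Z` is a resolution of it (`hasResolution_of_isERS`). Perfectness, smoothness and
irreducibility are carried, not used. [folklore] -/
theorem ersToEmbeddedSmoothRes_holds (p : ℕ) : ERSToEmbeddedSmoothRes p := by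
  intro hH K _ _ _ Z X g i hsep hlft hqc hsm hirr hi hint
  haveI := hlft; haveI := hqc; haveI := hsm; haveI := hirr; haveI := hi; haveI := hint
  haveI : IsLocallyNoetherian Z := LocallyOfFiniteType.isLocallyNoetherian g
  haveI : Nonempty X := IrreducibleSpace.toNonempty
  haveI : Nonempty i.ker.subscheme := ⟨i.toImage (Classical.arbitrary X)⟩
  haveI : IsIntegral i.ker.subscheme := isIntegral_of_isOpenImmersion (inv i.toImage)
  obtain ⟨Z', σ, X', hE⟩ := hH K Z g i.ker
  exact (hasResolution_of_isERS g i.ker hE).of_iso (inv i.toImage)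

/-- The typed §1 candidate at `p` (hypothesis) gives resolution over every PERFECT field of
characteristic `p` (`PerfectRes p`), by G8-a and `B0`. [folklore] -/
theorem perfectRes_of_hironakaERSPerfect {p : ℕ} (hH : HironakaERSPerfect p) : PerfectRes p :=
  b0_holds p (ersToEmbeddedSmoothRes_holds p hH)

/-- The typed §1 candidate at `p` and the `p`-slice of the crux stmt-0549 give `ResolutionInChar p`;
no other hypothesis. [folklore] -/
theorem resolutionInChar_of_hironakaERSPerfect_of_descentAt' (p : ℕ) (hd : DescentAt p)
    (hH : HironakaERSPerfect p) : ResolutionInChar.{0} p :=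
  resolutionInChar_of_hironakaERSPerfect_of_descentAt p (ersToEmbeddedSmoothRes_holds p) hd hH

/-- **The ladder, kernel form, with the crux as its only open hypothesis**: the TYPED §1 candidate read
with perfect `K` (`S01Introduction.MainClaimPerfect`, consumed as a hypothesis, never asserted) together
with `DescentPerfectToAll` (stmt-ResolutionOfSingularities-0549) gives the summit statement
`ResolutionOfSingularities`. [folklore] -/
theorem resolutionOfSingularities_of_mainClaimPerfect_of_descentPerfectToAll
    (hH : Literature.AlgebraicGeometry.Hironaka2017.S01Introduction.MainClaimPerfect.{0})
    (hd : Summit.ResolutionOfSingularities.ResolutionOfSingularities.Theses.Descent.DescentPerfectToAll) :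
    _root_.ResolutionOfSingularities :=
  resolutionOfSingularities_of_mainClaimPerfect hH (fun p _ => ersToEmbeddedSmoothRes_holds p) hd

/-- Conversely the summit statement contains `DescentPerfectToAll`; so, GIVEN the typed §1 candidate over
perfect fields, the summit is EQUIVALENT to the crux stmt-0549. [folklore] -/
theorem resolutionOfSingularities_iff_descentPerfectToAll_of_mainClaimPerfect
    (hH : Literature.AlgebraicGeometry.Hironaka2017.S01Introduction.MainClaimPerfect.{0}) :
    _root_.ResolutionOfSingularities ↔
      Summit.ResolutionOfSingularities.ResolutionOfSingularities.Theses.Descent.DescentPerfectToAll :=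
  ⟨fun h p hp _ => _root_.ResolutionOfSingularities_iff.mp h p hp,
    resolutionOfSingularities_of_mainClaimPerfect_of_descentPerfectToAll hH⟩

end Summit.ResolutionOfSingularities.ResolutionOfSingularities.Theorems

end
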